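import Summits.NavierStokesRegularity.NavierStokesRegularity.Theorems.EfficiencyFloorNearSaturationNearMaximiserSeqCoreQuadratic
import Mathlib.MeasureTheory.Measure.SeparableMeasure
import HarnessLib

/-!
# Route `EfficiencyFloor`, crux `NearSaturationNearMaximiser` (stmt-NavierStokesRegularity-25482) on the
# `ProductionEfficiencyDecay` ladder (stmt-22866): WEAK LIMITS IN `L²` AS FUNCTIONS (sequential Banach–Alaoglu)

Def-free helper file, eleventh of the group. The EXTRACTION half of clause (b''') of the by-name reductions of stmt-25482
(`…SeqCoreWeakCurl`, `…SeqCoreLocalProfile`): a sequence of fields bounded in `L²(ℝ³)` has a subsequence converging weakly in `L²`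
to an `L²` FUNCTION — Mathlib's sequential Banach–Alaoglu theorem (`WeakDual.isSeqCompact_closedBall`) in the separable Hilbert space
`L²(ℝ³; F)` (`Lp.SecondCountableTopology`), transported through the Riesz isometry `InnerProductSpace.toDual` and unpacked to functions
with `MemLp.coeFn_toLp`, `L2.inner_def`.

* `exists_subseq_weak_limit` — a norm-bounded sequence in a separable real Hilbert space has a weakly convergent subsequence;
* `exists_weakLimit_memLp_two` — for `f_k : ℝ³ → F` with `f_k ∈ L²`, `∫‖f_k‖² ≤ C`: there are `G ∈ L²` and a subsequence with
  `∫⟪f_{φk}, ψ⟫ → ∫⟪G, ψ⟫` for every `ψ ∈ L²`.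

What this does NOT give (and what remains of (b''')): the IDENTIFICATION of the weak limits of `∂ⱼ v_{φk}`, `∂ⱼ curl v_{φk}` with the
derivatives of one ADMISSIBLE (smooth, `L²`, divergence-free) profile `w` — regularity and decay of Lu–Doering extremisers.
HONEST FRAMING: stmt-25482, `LerayFloorGap`, `ProductionEfficiencyDecay` (stmt-22866) and Navier–Stokes regularity stay OPEN; no summit
statement is proved. [folklore]
-/

-- the problem directory repeats the summit name (`NavierStokesRegularity/NavierStokesRegularity`)
set_option linter.dupNamespace false

noncomputable section

namespace Summit.NavierStokesRegularity.NavierStokesRegularity.Theorems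

namespace NearSaturationNearMaximiser

namespace SeqCore

open Set MeasureTheory Filter Topology Function
open scoped InnerProductSpace ENNReal NNReal
open Literature.Analysis.FluidPDE

/-! ## §1 Sequential Banach–Alaoglu in a separable Hilbert space -/

/-- **A bounded sequence in a separable real Hilbert space has a weakly convergent subsequence**: if `‖x_n‖ ≤ r` then for some
`y` and a strictly increasing `φ`, `⟪x_{φ n}, z⟫ → ⟪y, z⟫` for every `z` (sequential Banach–Alaoglu for the dual ball, moved to `H`
by the Riesz representation). [folklore] -/
theorem exists_subseq_weak_limit {H : Type*} [NormedAddCommGroup H] [InnerProductSpace ℝ H] [CompleteSpace H]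
    [TopologicalSpace.SeparableSpace H] {x : ℕ → H} {r : ℝ} (hx : ∀ n, ‖x n‖ ≤ r) :
    ∃ y : H, ∃ φ : ℕ → ℕ, StrictMono φ ∧ ∀ z : H, Tendsto (fun n => ⟪x (φ n), z⟫_ℝ) atTop (𝓝 ⟪y, z⟫_ℝ) := by
  have hmem : ∀ n, (fun n => StrongDual.toWeakDual (InnerProductSpace.toDual ℝ H (x n))) n ∈
      WeakDual.toStrongDual ⁻¹' Metric.closedBall (0 : StrongDual ℝ H) r := by
    intro n
    simp only [Set.mem_preimage, Metric.mem_closedBall, dist_zero_right, StrongDual.toStrongDual_toWeakDual]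
    rw [LinearIsometryEquiv.norm_map]
    exact hx n
  obtain ⟨ℓ, -, φ, hφ, hlim⟩ := (WeakDual.isSeqCompact_closedBall ℝ H (0 : StrongDual ℝ H) r) hmem
  refine ⟨(InnerProductSpace.toDual ℝ H).symm (WeakDual.toStrongDual ℓ), φ, hφ, fun z => ?_⟩
  have h := (tendsto_iff_forall_eval_tendsto_topDualPairing.1 hlim) z
  rw [InnerProductSpace.toDual_symm_apply]
  have h' : Tendsto (fun n => ⟪x (φ n), z⟫_ℝ) atTop (𝓝 ((WeakDual.toStrongDual ℓ) z)) :=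
    h.congr' (Eventually.of_forall fun n => rfl)
  exact h'

/-! ## §2 Weak limits in `L²(ℝ³)` as functions -/

/-- `‖hf.toLp f‖ ≤ √C` in `L²` when `∫‖f‖² ≤ C`. [folklore] -/
theorem norm_toLp_le_sqrt {F : Type*} [NormedAddCommGroup F] {f : EuclideanSpace ℝ (Fin 3) → F}
    (hf : MemLp f 2 volume) {C : ℝ} (hC : ∫ x, ‖f x‖ ^ 2 ≤ C) : ‖hf.toLp f‖ ≤ Real.sqrt C := by
  rw [Lp.norm_toLp, hf.eLpNorm_eq_integral_rpow_norm (by norm_num) (by norm_num), ENNReal.toReal_ofReal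
    (Real.rpow_nonneg (integral_nonneg fun x => Real.rpow_nonneg (norm_nonneg _) _) _)]
  simp only [ENNReal.toReal_ofNat, Real.rpow_two]
  rw [← one_div, ← Real.sqrt_eq_rpow]
  exact Real.sqrt_le_sqrt hC

/-- **Weak limits in `L²` as functions.** If `f_k : ℝ³ → F` lie in `L²` with `∫‖f_k‖² ≤ C`, then there are `G ∈ L²` and a strictly
increasing `φ` with `∫⟪f_{φ k}, ψ⟫ → ∫⟪G, ψ⟫` for every `ψ ∈ L²` (`F` a separable real Hilbert space, e.g. `ℝ³`). [folklore] -/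
theorem exists_weakLimit_memLp_two {F : Type*} [NormedAddCommGroup F] [InnerProductSpace ℝ F] [CompleteSpace F]
    [SecondCountableTopology F] {f : ℕ → EuclideanSpace ℝ (Fin 3) → F} (hf : ∀ k, MemLp (f k) 2 volume) {C : ℝ}
    (hC : ∀ k, ∫ x, ‖f k x‖ ^ 2 ≤ C) :
    ∃ G : EuclideanSpace ℝ (Fin 3) → F, MemLp G 2 volume ∧ ∃ φ : ℕ → ℕ, StrictMono φ ∧
      ∀ ψ : EuclideanSpace ℝ (Fin 3) → F, MemLp ψ 2 volume →
        Tendsto (fun k => ∫ x, ⟪f (φ k) x, ψ x⟫_ℝ) atTop (𝓝 (∫ x, ⟪G x, ψ x⟫_ℝ)) := by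
  borelize F
  haveI : Fact ((2 : ℝ≥0∞) ≠ ∞) := ⟨ENNReal.ofNat_ne_top⟩
  have hxn : ∀ k, ‖(hf k).toLp (f k)‖ ≤ Real.sqrt C := fun k => norm_toLp_le_sqrt (hf k) (hC k)
  obtain ⟨y, φ, hφ, hlim⟩ := exists_subseq_weak_limit (H := Lp F 2 (volume : Measure (EuclideanSpace ℝ (Fin 3))))
    (x := fun k => (hf k).toLp (f k)) hxn
  refine ⟨y, Lp.memLp y, φ, hφ, fun ψ hψ => ?_⟩
  have h := hlim (hψ.toLp ψ)
  have e1 : ∀ k, ⟪(hf (φ k)).toLp (f (φ k)), hψ.toLp ψ⟫_ℝ = ∫ a, ⟪f (φ k) a, ψ a⟫_ℝ := fun k => by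
    rw [MeasureTheory.L2.inner_def]
    exact integral_congr_ae (((hf (φ k)).coeFn_toLp).mp ((hψ.coeFn_toLp).mono fun a ha hb => by simp only [ha, hb]))
  have e2 : ⟪y, hψ.toLp ψ⟫_ℝ = ∫ a, ⟪y a, ψ a⟫_ℝ := by
    rw [MeasureTheory.L2.inner_def]
    exact integral_congr_ae ((hψ.coeFn_toLp).mono fun a ha => by simp only [ha])
  rw [e2] at h
  exact h.congr e1

end SeqCore

end NearSaturationNearMaximiser

end Summit.NavierStokesRegularity.NavierStokesRegularity.Theorems

end
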